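/-
COR-CM (cell pub-hodgecm2, stage 2 of the Hodge ladder) — TRANSPOSITION SURGE, item (vi) sub-binder S2 / (vi-2) `supply`
(hodge-director/ITEM6-SPLIT.md §(c) S2, §(c′) (vi-2); prover queue item6-p1).  Seat prover-pub-hodgecm2-item6-p1-0.
Theorems only: no definition, no named fact, no `sorry`, nothing asserted; `Transposition/Assembly.lean` (p271429),
`Transposition/Item6SupplyAssembly.lean` (p272758), `Interfaces.lean` (C1) untouched.  FRAMING: HC_CM is NOT proved.
-/
import Summits.HodgeConjecture.CorCM.B01.FaceSupplyAlbaneseHom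
import Summits.HodgeConjecture.CorCM.FaceSupplyTypewise
import Summits.HodgeConjecture.CorCM.StubTree.Combinatorics
import Summits.HodgeConjecture.CorCM.Proofs.Landherr
import HarnessLib

/-!
# Item (vi) S2 — the SUPPLY witness on the universe of record from CM-Albanese reach

With SATURATED theta sets (`Theta i Γ := U.Uiso Γ F (f.psi i) ι₁`) the content of item (vi) is its supply clause
(`Transposition.FaceThetaSupply.supply`, `Item6SupplyAssembly.lean`:97), in the ∃ι₁ ∃V form the day-1 assembly consumes
(`exists_faceThetaDatum_of_items` :339): for every Galois CM field `F` with `6 ≤ [F:ℚ]` and every rank-four face `f`,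

  `∃ ι₁ admissible, ∃ V, ∃ Γ, ∃ ω₀ ∈ U_{ψ₀}(Γ)_{ι₁}, ∃ ω₁ ∈ U_{ψ₁}(Γ)_{ι₁}, ω₀ ≠ 0 ∧ ω₁ ≠ 0`        (S2-∃)

This file isolates, on the universe of record `U_rec = Model.picardCMUniverse hHD hI h₁ h₃`, exactly what the automorphic
side must deliver for (S2-∃) and proves the rest in the kernel:

* §1 `Model.exists_supplyWitness_of_exists_albaneseReach` — (S2-∃) from CM-ALBANESE REACH AT ONE `(ι₁, V)` PER FACE: if for
  every face there are an admissible `ι₁`, a hermitian 3-space `V`, and (at possibly different levels) non-zero homomorphisms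
  `Alb(P_{Γ₀}(V)) → A_{(F,ψ₀)}`, `Alb(P_{Γ₁}(V)) → A_{(F,ψ₁)}`, then (S2-∃) holds — isotypicity is free
  (`picardCMUniverse_Uiso_ne_bot_iff_exists_hom_ne_zero`, `ι₁ ∈ ψ_i` by admissibility) and the two levels join at `Γ₀ ⊓ Γ₁`
  (`exists_mem_uiso_ne_zero_of_le_of_two_lt`).
* §2 `Model.faceSupply_of_albaneseFactor` / `Model.exists_supplyWitness_of_albaneseFactor` — the S2 SOCKET in the shape
  [Liu2021] Cor. 4.20 (`A_K ∼ ∏_μ A_μ^{d(μ,K)}`, every weight-one `μ`, every incoherent `𝕍`) delivers once the object matches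
  of `S2-ASPRINTED-CHAIN.md` (C6a: a component of `Sh(𝕍)_K ⊗_{E,ι₁} ℂ` is the realised `P_Γ(V)`, Albanese compatible;
  C6b*: `A_μ ⊗_{E,ι₁} ℂ` — isotypic of the INVERSE type `Φ_μ^{*ι₁}` by [Liu2021] Def. 4.5 (2), tree
  `Liu2021.LiuCMData.cmType_eq_induced_of_det45` — and the realised `A_{(F,Φ)}` share a simple factor when `Φ_μ ∈ Gal·Φ^{*ι₁}`)
  are supplied: «for every CM type `Φ ∋ ι₁` and every `V`, some `P_Γ(V)` has `Hom(Alb(P_Γ), A_{(F,Φ)}) ≠ 0`» ⇒ B01-S `FaceSupply`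
  (∀ι₁ ∀V) ⇒ (S2-∃).  The hypotheses below are `μ`-free.
* §3 the closed instance on the universe OF RECORD (all four data tree theorems).

Nothing automorphic is discharged here: the hypothesis of §2 is what [Liu2021] Thm. 4.18 / Cor. 4.20 AS PRINTED give only
modulo the object-match binders C0/C6a/C6b* (ITEM6-SPLIT §5); the index-set clause «`ε` is `μ`-admissible» (Def. 4.12) is
already a tree theorem for every CM type (`Literature.AlgebraicGeometry.Liu2021.exists_isAdmissibleElement_of_cmType`,
`Liu2021/AdmissibleElement.lean`).  HC_CM is NOT proved.

References: Y. Liu, *Fourier–Jacobi cycles and arithmetic relative trace formula*, Camb. J. Math. 9 (2021), Thm. 4.18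
(`FJcycle.tex` ll. 2232–2245), Cor. 4.20 (ll. 2301–2316); V. K. Murty, D. Ramakrishnan, *The
Albanese of unitary Shimura varieties* (1992).
-/

noncomputable section

open CategoryTheory AlgebraicGeometry
open Literature.AlgebraicGeometry.Motives
open Literature.AlgebraicGeometry.HodgeTheory
open Literature.NumberTheory.Automorphic.PicardCM

namespace Summit.HodgeConjecture.CorCM

/-! ## §1  (S2-∃) from CM-Albanese reach at ONE `(ι₁, V)` per face -/

namespace Model

section Data

/-- **(S2-∃) from Albanese reach at one `(ι₁, V)` per face** (`U = picardCMUniverse hHD hI h₁ h₃`).  If every face of every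
Galois CM field of degree `≥ 6` has an admissible `ι₁`, a hermitian 3-space `V` at `ι₁`, and — at SOME levels `Γ₀`, `Γ₁` of
the `V`-tower, for some Albanese data — non-zero homomorphisms `Alb(P_{Γ₀}) → A_{(F,ψ₀)}` and `Alb(P_{Γ₁}) → A_{(F,ψ₁)}`, then at
ONE level there are non-zero classes of `U_{ψ₀}(Γ)_{ι₁}` and `U_{ψ₁}(Γ)_{ι₁}` (the `supply` clause of item (vi) for the saturated
theta sets, ∃ι₁ ∃V form).  Isotypicity is free (`picardCMUniverse_Uiso_ne_bot_iff_exists_hom_ne_zero`, `ι₁ ∈ ψ_i` by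
`admissible_mem_psi`); the levels join at `Γ₀ ⊓ Γ₁` (`exists_mem_uiso_ne_zero_of_le_of_two_lt`). [folklore] -/
theorem exists_supplyWitness_of_exists_albaneseReach
    (hHD : exists_isReal_hodgeModel) (hI : hodgePQ_independent_of_hodgeModel)
    (h₁ : BallQuotientUniformised) (h₃ : CMAbelianVarietyRealised)
    (h : ∀ (F : CMField), IsGalois ℚ F → 6 ≤ Module.finrank ℚ F → ∀ f : Face F,
      ∃ ι₁ : F →+* ℂ, f.Admissible ι₁ ∧ ∃ V : HermSpace3 F ι₁,
        (∃ (Γ : Level V) (𝒥 : Jacobian (Var.scheme (ballQuotientUniformisedDatum_of h₁) h₃ (.pms (pmsCode F ι₁ V Γ))))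
            (u : 𝒥.J ⟶ (cmRealisation h₃ (cmCode F (f.psi 0))).AV), u ≠ 0) ∧
        (∃ (Γ : Level V) (𝒥 : Jacobian (Var.scheme (ballQuotientUniformisedDatum_of h₁) h₃ (.pms (pmsCode F ι₁ V Γ))))
            (u : 𝒥.J ⟶ (cmRealisation h₃ (cmCode F (f.psi 1))).AV), u ≠ 0)) :
    ∀ (F : CMField), IsGalois ℚ F → 6 ≤ Module.finrank ℚ F → ∀ f : Face F,
      ∃ ι₁ : F →+* ℂ, f.Admissible ι₁ ∧ ∃ (V : HermSpace3 F ι₁) (Γ : Level V)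
        (ω₀ ω₁ : (picardCMUniverse hHD hI h₁ h₃).CohC ((picardCMUniverse hHD hI h₁ h₃).pms F ι₁ V Γ) 1),
        ω₀ ∈ (picardCMUniverse hHD hI h₁ h₃).Uiso Γ F (f.psi 0) ι₁ ∧
          ω₁ ∈ (picardCMUniverse hHD hI h₁ h₃).Uiso Γ F (f.psi 1) ι₁ ∧ ω₀ ≠ 0 ∧ ω₁ ≠ 0 := by
  intro F hG h6 f
  obtain ⟨ι₁, hι, V, ⟨Γ₀, 𝒥₀, u₀, hu₀⟩, ⟨Γ₁, 𝒥₁, u₁, hu₁⟩⟩ := h F hG h6 f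
  have hF : 2 < Module.finrank ℚ F := by omega
  have hne₀ : (picardCMUniverse hHD hI h₁ h₃).Uiso Γ₀ F (f.psi 0) ι₁ ≠ ⊥ :=
    (picardCMUniverse_Uiso_ne_bot_iff_exists_hom_ne_zero Γ₀ F (f.psi 0) (admissible_mem_psi f ι₁ hι 0) 𝒥₀).2 ⟨u₀, hu₀⟩
  have hne₁ : (picardCMUniverse hHD hI h₁ h₃).Uiso Γ₁ F (f.psi 1) ι₁ ≠ ⊥ :=
    (picardCMUniverse_Uiso_ne_bot_iff_exists_hom_ne_zero Γ₁ F (f.psi 1) (admissible_mem_psi f ι₁ hι 1) 𝒥₁).2 ⟨u₁, hu₁⟩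
  obtain ⟨ω₀, h₀, hω₀⟩ := (Submodule.ne_bot_iff _).1 hne₀
  obtain ⟨ω₁, h₁', hω₁⟩ := (Submodule.ne_bot_iff _).1 hne₁
  obtain ⟨η₀, hη₀, hη₀ne⟩ := exists_mem_uiso_ne_zero_of_le_of_two_lt hHD hI h₁ h₃ hF (Γ := Γ₀) (Γ' := Γ₀ ⊓ Γ₁)
    (by rw [Level.inf_Γ]; exact inf_le_left) ⟨ω₀, h₀, hω₀⟩
  obtain ⟨η₁, hη₁, hη₁ne⟩ := exists_mem_uiso_ne_zero_of_le_of_two_lt hHD hI h₁ h₃ hF (Γ := Γ₁) (Γ' := Γ₀ ⊓ Γ₁)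
    (by rw [Level.inf_Γ]; exact inf_le_right) ⟨ω₁, h₁', hω₁⟩
  exact ⟨ι₁, hι, V, Γ₀ ⊓ Γ₁, η₀, η₁, hη₀, hη₁, hη₀ne, hη₁ne⟩

/-! ## §2  The S2 socket: CM-Albanese factor for every CM type ⇒ B01-S ⇒ (S2-∃) -/

/-- **B01-S from CM-Albanese reach of every CM type** (`U = picardCMUniverse hHD hI h₁ h₃`): if for every Galois CM field
`F` with `6 ≤ [F:ℚ]`, every CM type `Φ ∋ ι₁` and every hermitian 3-space `V` at `ι₁` some compact Picard modular surface
`P_Γ(V)` of the tower has `Hom(Alb(P_Γ), A_{(F,Φ)}) ≠ 0` (for some Albanese datum), then `U.FaceSupply` — the shape in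
which [Liu2021] Cor. 4.20 (every weight-one `μ` is an isogeny factor of `Alb(Sh(𝕍)_K)`, every `𝕍`) delivers once the
component / CM-datum object matches are supplied (ITEM6-SPLIT §5).  Through `faceSupply_iff_typewise` and
`picardCMUniverse_Uiso_ne_bot_iff_exists_hom_ne_zero`. [cite: Liu2021, Cor. 4.20] -/
theorem faceSupply_of_albaneseFactor
    (hHD : exists_isReal_hodgeModel) (hI : hodgePQ_independent_of_hodgeModel)
    (h₁ : BallQuotientUniformised) (h₃ : CMAbelianVarietyRealised)
    (h : ∀ (F : CMField), IsGalois ℚ F → 6 ≤ Module.finrank ℚ F →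
      ∀ (Φ : CMType F) (ι₁ : F →+* ℂ), ι₁ ∈ Φ.1 → ∀ V : HermSpace3 F ι₁,
        ∃ (Γ : Level V) (𝒥 : Jacobian (Var.scheme (ballQuotientUniformisedDatum_of h₁) h₃ (.pms (pmsCode F ι₁ V Γ))))
          (u : 𝒥.J ⟶ (cmRealisation h₃ (cmCode F Φ)).AV), u ≠ 0) :
    (picardCMUniverse hHD hI h₁ h₃).FaceSupply := by
  rw [faceSupply_iff_typewise hHD hI h₁ h₃]
  intro F hG h6 Φ ι₁ hι V
  obtain ⟨Γ, 𝒥, u, hu⟩ := h F hG h6 Φ ι₁ hι V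
  have hne : (picardCMUniverse hHD hI h₁ h₃).Uiso Γ F Φ ι₁ ≠ ⊥ :=
    (picardCMUniverse_Uiso_ne_bot_iff_exists_hom_ne_zero Γ F Φ hι 𝒥).2 ⟨u, hu⟩
  obtain ⟨ω, hω, hω0⟩ := (Submodule.ne_bot_iff _).1 hne
  exact ⟨Γ, ω, hω, hω0⟩

/-- **B01-S implies (S2-∃)** (any admissible `ι₁` — `StubTree.admissible_exists` — and any hermitian 3-space at it —
`landherr_exists_proof` — will do; both tree theorems): the ∀ι₁ ∀V supply leaf gives the ∃ι₁ ∃V supply witness the day-1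
assembly consumes. [folklore] -/
theorem exists_supplyWitness_of_faceSupply (hHD : exists_isReal_hodgeModel) (hI : hodgePQ_independent_of_hodgeModel)
    (h₁ : BallQuotientUniformised) (h₃ : CMAbelianVarietyRealised)
    (hS : (picardCMUniverse hHD hI h₁ h₃).FaceSupply) :
    ∀ (F : CMField), IsGalois ℚ F → 6 ≤ Module.finrank ℚ F → ∀ f : Face F,
      ∃ ι₁ : F →+* ℂ, f.Admissible ι₁ ∧ ∃ (V : HermSpace3 F ι₁) (Γ : Level V)
        (ω₀ ω₁ : (picardCMUniverse hHD hI h₁ h₃).CohC ((picardCMUniverse hHD hI h₁ h₃).pms F ι₁ V Γ) 1),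
        ω₀ ∈ (picardCMUniverse hHD hI h₁ h₃).Uiso Γ F (f.psi 0) ι₁ ∧
          ω₁ ∈ (picardCMUniverse hHD hI h₁ h₃).Uiso Γ F (f.psi 1) ι₁ ∧ ω₀ ≠ 0 ∧ ω₁ ≠ 0 := by
  intro F hG h6 f
  obtain ⟨ι₁, hι⟩ := StubTree.admissible_exists F h6 f
  obtain ⟨V⟩ := landherr_exists_proof F ι₁
  obtain ⟨Γ, ω₀, ω₁, h₀, h₁', hne₀, hne₁⟩ := hS F hG h6 f ι₁ hι V
  exact ⟨ι₁, hι, V, Γ, ω₀, ω₁, h₀, h₁', hne₀, hne₁⟩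

/-- **(S2-∃) from CM-Albanese reach of every CM type** — §2's socket composed with `exists_supplyWitness_of_faceSupply`.
[cite: Liu2021, Cor. 4.20] -/
theorem exists_supplyWitness_of_albaneseFactor
    (hHD : exists_isReal_hodgeModel) (hI : hodgePQ_independent_of_hodgeModel)
    (h₁ : BallQuotientUniformised) (h₃ : CMAbelianVarietyRealised)
    (h : ∀ (F : CMField), IsGalois ℚ F → 6 ≤ Module.finrank ℚ F →
      ∀ (Φ : CMType F) (ι₁ : F →+* ℂ), ι₁ ∈ Φ.1 → ∀ V : HermSpace3 F ι₁,
        ∃ (Γ : Level V) (𝒥 : Jacobian (Var.scheme (ballQuotientUniformisedDatum_of h₁) h₃ (.pms (pmsCode F ι₁ V Γ))))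
          (u : 𝒥.J ⟶ (cmRealisation h₃ (cmCode F Φ)).AV), u ≠ 0) :
    ∀ (F : CMField), IsGalois ℚ F → 6 ≤ Module.finrank ℚ F → ∀ f : Face F,
      ∃ ι₁ : F →+* ℂ, f.Admissible ι₁ ∧ ∃ (V : HermSpace3 F ι₁) (Γ : Level V)
        (ω₀ ω₁ : (picardCMUniverse hHD hI h₁ h₃).CohC ((picardCMUniverse hHD hI h₁ h₃).pms F ι₁ V Γ) 1),
        ω₀ ∈ (picardCMUniverse hHD hI h₁ h₃).Uiso Γ F (f.psi 0) ι₁ ∧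
          ω₁ ∈ (picardCMUniverse hHD hI h₁ h₃).Uiso Γ F (f.psi 1) ι₁ ∧ ω₀ ≠ 0 ∧ ω₁ ≠ 0 :=
  exists_supplyWitness_of_faceSupply hHD hI h₁ h₃ (faceSupply_of_albaneseFactor hHD hI h₁ h₃ h)

end Data

/-! ## §3  The universe OF RECORD (all four data are tree theorems) -/

section EndState

/-- **The S2 socket on the universe of record**: CM-Albanese reach of every CM type of every Galois CM field of degree `≥ 6`
on every `V`-tower ⇒ the displayed leaf B01-S `FaceSupply` of `U_rec` (hence, by `exists_supplyWitness_of_faceSupply`, the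
supply clause of item (vi) in the ∃ι₁ ∃V form).  The hypothesis is what [Liu2021] Thm. 4.18 / Cor. 4.20 AS PRINTED give modulo
the object-match binders of ITEM6-SPLIT §5; HC_CM is NOT proved. [cite: Liu2021, Cor. 4.20] -/
theorem faceSupply_closed_of_albaneseFactor
    (h : ∀ (F : CMField), IsGalois ℚ F → 6 ≤ Module.finrank ℚ F →
      ∀ (Φ : CMType F) (ι₁ : F →+* ℂ), ι₁ ∈ Φ.1 → ∀ V : HermSpace3 F ι₁,
        ∃ (Γ : Level V) (𝒥 : Jacobian (Var.scheme (ballQuotientUniformisedDatum_of BallQuotient.ballQuotientUniformised_holds)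
            cmAbelianVarietyRealised_holds (.pms (pmsCode F ι₁ V Γ))))
          (u : 𝒥.J ⟶ (cmRealisation cmAbelianVarietyRealised_holds (cmCode F Φ)).AV), u ≠ 0) :
    (picardCMUniverse exists_isReal_hodgeModel_holds hodgePQ_independent_of_hodgeModel_holds
      BallQuotient.ballQuotientUniformised_holds cmAbelianVarietyRealised_holds).FaceSupply :=
  faceSupply_of_albaneseFactor _ _ _ _ h

end EndState

end Model

end Summit.HodgeConjecture.CorCM

end
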